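/-
Copyright (c) 2026 the pub-hodgecm-mathlib formalisation cell (harness21).  Prover seat hodgecm-mathlib-LH4-p07 (g8), req620 Track A «(D-RAM) FOUR-FRAME» squad
(STAGE-1b pre-scoping, heir LEAD F0P3a-plan (g20∕g21) T19-24 clause; dealer LH4-plan (g12∕g13) WORD #36 «p07 (g8): row-(2) lead»), 2026-09-04.
-/
import Summits.HodgeConjecture.HodgeConjecture.Theorems.F0P3cDyRamFixedPointCensusTypeTwoPrelude   -- ★ (LH4-p14 (g4)): `setOf_typeZero_fixed_eq_setOf_isSelfDualLattice_block`, `antidiagonal_three_over_eq_block_antidiagonal_two`; brings `placeForm`, `IsVertexLattice`, `mapGL`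
import Summits.HodgeConjecture.HodgeConjecture.Theorems.F0P3cDyRamFourFrameCensusDefs          -- ★ DEFS (dealer g10): `LatticeInLevel ϖ ℓ X M := M.map X ≤ ϖ^ℓ·M`
import HarnessLib

/-!
# Crux `H413`, line LH4 «(D-RAM) FOUR-FRAME» — STAGE-1b, row (2): (L0-P) «THE UNLABELLED PROFILE PIECES' LATTICE COUNTS ARE THE BLOCK-FORM CENSUS FAMILIES, ON THE NOSE»

Cell `hodgecm-mathlib` (D-0151), FLOOR 0, crux item H413 = `stmt-HodgeConjecture-24833`, route of record `HCCMUnconditional`; squad F0∕P3c∕LH4; lane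
`--supports stmt-HodgeConjecture-24833 --as helper` (count-neutral; pays NO tier-0 row).  THEOREMS ONLY (no `def`, no instance, no notation, no `sorry`).  Letter-level bookkeeping in
the EXACT tokens of ★ p858704 `pieceCountDictionary_levels ∕ _sqLevel` (B-side of the (D-G) dictionary) and of ★ p859229 ∕ p859051 ∕ p858894 (this seat's order-form censuses).

THE SEAM.  ★ p858704 turns the `G`-side orbital integral of an unlabelled profile piece at a wild place `w` into the lattice count
`#{M ∣ IsVertexLattice σ_w ϖ ((StdForm.antidiagonal 3).over L_w) 0 M ∧ T·M = M ∧ LatticeInLevel ϖ a (T − 1) M ∧ LatticeInLevel ϖ b ((T − 1)²) M}` (levels piece `lev_{a,b} = K_{a,b}`; the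
square piece drops the `a`-clause).  The row-(2) order-form censuses of this seat count `{L ∣ IsSelfDualLattice σ ϖ !![H₂ 0 0, 0, H₂ 0 1; 0, hW, 0; H₂ 1 0, 0, H₂ 1 1] L ∧ Γ·L = L ∧
L.map (Γ − 1) ≤ c·L ∧ L.map ((Γ − 1)²) ≤ c′·L}`.  These are THE SAME SET for every `Γ = T`, `c = ϖ^a`, `c′ = ϖ^b`, with `(H₂, hW) := (placeForm Φ₂ w, 1)`: the antidiagonal form of rank 3
IS the block form of the antidiagonal form of rank 2 (★ Prelude `antidiagonal_three_over_eq_block_antidiagonal_two`, ★ `placeForm_antidiagOne`), `IsSelfDualLattice` is `IsVertexLattice … 0`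
by `abbrev`, and `LatticeInLevel ϖ ℓ X M` is `M.map X ≤ scaleLattice (ϖ^ℓ) M` by DEFINITION (★ DEFS `FourFrameCensusDefs`).  So no frame change, no transport lemma and no evenness adapter sit
between the dictionary and the census: the type-(2) literal `T = ι_w(t) = endoGL (ι_w γ_H.1, ι_w γ_H.2)` is fed to ★ p859229 (`K_{a,b}`), ★ p859051 (`sqLevel_b`), ★ p858894 (depth) as is.
* §1 `setOf_typeZero_fixed_levels_eq_block` (both tokens), `setOf_typeZero_fixed_sqLevel_eq_block` (square token), `setOf_typeZero_fixed_level_eq_block` (depth token), and their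
  `ncard` forms — all `rw [placeForm_antidiagOne, ← antidiagonal_three_over_eq_block_antidiagonal_two]` + `rfl` (the Prelude's seam S4 with the piece clauses carried along).
HONEST LABEL.  Count-neutral letter bookkeeping; nothing printed is asserted; no census law is stated; `HC_CM` is proved only modulo the 7 printed citations (2 remaining named inputs:
hLiu418 = `stmt-HodgeConjecture-24832`, h413 = `stmt-HodgeConjecture-24833`) until rung 0 closes.

## References
* [Kottwitz1986BaseChangeUnits] R. E. Kottwitz, *Base change for unit elements of Hecke algebras*, Compositio Math. 60 (1986): §1 pp. 240–241.
* [Rogawski1990] J. D. Rogawski, *Automorphic Representations of Unitary Groups in Three Variables*, Ann. of Math. Stud. 123 (1990): §4.3 p. 43; §4.9 Prop. 4.9.1 (b) p. 55.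
-/

set_option autoImplicit false

noncomputable section

namespace Summit.HodgeConjecture.HodgeConjecture.Cruxes.H413.F0P3cDyRamProfilePiecesTypeTwoLatticeBridge

open MeasureTheory Measure NumberField IsDedekindDomain Topology Filter
open Literature.NumberTheory.Automorphic Literature.NumberTheory.Automorphic.UnitaryGroup Literature.NumberTheory.Automorphic.IntegralReduction
open Literature.NumberTheory.Rogawski1990 Literature.NumberTheory.GaloisRepresentations
open Literature.NumberTheory.Automorphic.UnitaryThreeFourFrame
open scoped Matrix MatrixGroups Classical ValuativeRel
open Literature.NumberTheory.Automorphic.UnitaryLatticeTree Literature.NumberTheory.Automorphic.HermitianLattice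
open Summit.HodgeConjecture.HodgeConjecture.Cruxes.H413.F0P3cDyRamFourFrameCensusDefs
open Summit.HodgeConjecture.HodgeConjecture.Cruxes.H413.F0P3cDyRamFixedPointCensusTypeTwoPrelude

/-! ## §1 The three unlabelled pieces' lattice counts, read in the block form `(placeForm Φ₂ w, 1)` -/

/-- **(L0-P) THE LEVELS PIECE `lev_{a,b} = K_{a,b}`**: for ANY `Γ : GL₃(L_w)` and any `a b`, the B-side count set of ★ `pieceCountDictionary_levels` IS the family counted by ★ p859229
`ncard_fixed_selfDual_endoGL_lev_sq_eq_orderForm` for the block form `(H₂, hW) := (placeForm Φ₂ w, 1)`, `c := ϖ^a`, `c′ := ϖ^b` — same set, token for token.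
[cite: Kottwitz1986BaseChangeUnits, §1 pp. 240–241] [cite: Rogawski1990, §4.3 p. 43; §4.9 Prop. 4.9.1 (b) p. 55] -/
theorem setOf_typeZero_fixed_levels_eq_block (L : Type) [Field L] [NumberField L] [IsCMField L]
    {v : HeightOneSpectrum (𝓞 ↥(maximalRealSubfield L))} (w : UnitaryGroup.PlacesOver L v)
    (hw : IsCMField.complexConj L • w.1 = w.1) (ϖ : w.1.adicCompletion L) (Γ : GL (Fin 3) (w.1.adicCompletion L)) (a b : ℕ) :
    {M : Submodule (Valued.integer (w.1.adicCompletion L)) (Fin 3 → (w.1.adicCompletion L)) |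
        IsVertexLattice (galAdicCompletionMap (L := L) (IsCMField.complexConj L) hw) ϖ ((StdForm.antidiagonal 3).over (w.1.adicCompletion L)) 0 M ∧ mapGL Γ M = M ∧
          (LatticeInLevel ϖ a ((Γ : Matrix (Fin 3) (Fin 3) (w.1.adicCompletion L)) - 1) M ∧
            LatticeInLevel ϖ b (((Γ : Matrix (Fin 3) (Fin 3) (w.1.adicCompletion L)) - 1) * ((Γ : Matrix (Fin 3) (Fin 3) (w.1.adicCompletion L)) - 1)) M)} =
      {M : Submodule (Valued.integer (w.1.adicCompletion L)) (Fin 3 → (w.1.adicCompletion L)) |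
        IsSelfDualLattice (galAdicCompletionMap (L := L) (IsCMField.complexConj L) hw) ϖ
          (!![(placeForm (Matrix.of fun i j : Fin 2 => if i.val + j.val + 1 = 2 then (1 : L) else 0) w.1) 0 0, 0,
              (placeForm (Matrix.of fun i j : Fin 2 => if i.val + j.val + 1 = 2 then (1 : L) else 0) w.1) 0 1;
             0, (1 : w.1.adicCompletion L), 0;
             (placeForm (Matrix.of fun i j : Fin 2 => if i.val + j.val + 1 = 2 then (1 : L) else 0) w.1) 1 0, 0,
              (placeForm (Matrix.of fun i j : Fin 2 => if i.val + j.val + 1 = 2 then (1 : L) else 0) w.1) 1 1] : Matrix (Fin 3) (Fin 3) (w.1.adicCompletion L)) M ∧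
        mapGL Γ M = M ∧
          M.map ((Matrix.toLin' ((Γ : Matrix (Fin 3) (Fin 3) (w.1.adicCompletion L)) - 1)).restrictScalars (Valued.integer (w.1.adicCompletion L))) ≤ scaleLattice (ϖ ^ a) M ∧
          M.map ((Matrix.toLin' (((Γ : Matrix (Fin 3) (Fin 3) (w.1.adicCompletion L)) - 1) * ((Γ : Matrix (Fin 3) (Fin 3) (w.1.adicCompletion L)) - 1))).restrictScalars
            (Valued.integer (w.1.adicCompletion L))) ≤ scaleLattice (ϖ ^ b) M} := by
  rw [placeForm_antidiagOne, ← antidiagonal_three_over_eq_block_antidiagonal_two]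
  rfl

/-- **(L0-P) THE SQUARE PIECE `sqLevel_b`** (★ `pieceCountDictionary_sqLevel`'s B-side = ★ p859051's family at `c := ϖ^b`, `(H₂, hW) := (placeForm Φ₂ w, 1)`).
[cite: Kottwitz1986BaseChangeUnits, §1 pp. 240–241] [cite: Rogawski1990, §4.9 Prop. 4.9.1 (b) p. 55] -/
theorem setOf_typeZero_fixed_sqLevel_eq_block (L : Type) [Field L] [NumberField L] [IsCMField L]
    {v : HeightOneSpectrum (𝓞 ↥(maximalRealSubfield L))} (w : UnitaryGroup.PlacesOver L v)
    (hw : IsCMField.complexConj L • w.1 = w.1) (ϖ : w.1.adicCompletion L) (Γ : GL (Fin 3) (w.1.adicCompletion L)) (b : ℕ) :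
    {M : Submodule (Valued.integer (w.1.adicCompletion L)) (Fin 3 → (w.1.adicCompletion L)) |
        IsVertexLattice (galAdicCompletionMap (L := L) (IsCMField.complexConj L) hw) ϖ ((StdForm.antidiagonal 3).over (w.1.adicCompletion L)) 0 M ∧ mapGL Γ M = M ∧
          LatticeInLevel ϖ b (((Γ : Matrix (Fin 3) (Fin 3) (w.1.adicCompletion L)) - 1) * ((Γ : Matrix (Fin 3) (Fin 3) (w.1.adicCompletion L)) - 1)) M} =
      {M : Submodule (Valued.integer (w.1.adicCompletion L)) (Fin 3 → (w.1.adicCompletion L)) |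
        IsSelfDualLattice (galAdicCompletionMap (L := L) (IsCMField.complexConj L) hw) ϖ
          (!![(placeForm (Matrix.of fun i j : Fin 2 => if i.val + j.val + 1 = 2 then (1 : L) else 0) w.1) 0 0, 0,
              (placeForm (Matrix.of fun i j : Fin 2 => if i.val + j.val + 1 = 2 then (1 : L) else 0) w.1) 0 1;
             0, (1 : w.1.adicCompletion L), 0;
             (placeForm (Matrix.of fun i j : Fin 2 => if i.val + j.val + 1 = 2 then (1 : L) else 0) w.1) 1 0, 0,
              (placeForm (Matrix.of fun i j : Fin 2 => if i.val + j.val + 1 = 2 then (1 : L) else 0) w.1) 1 1] : Matrix (Fin 3) (Fin 3) (w.1.adicCompletion L)) M ∧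
        mapGL Γ M = M ∧
          M.map ((Matrix.toLin' (((Γ : Matrix (Fin 3) (Fin 3) (w.1.adicCompletion L)) - 1) * ((Γ : Matrix (Fin 3) (Fin 3) (w.1.adicCompletion L)) - 1))).restrictScalars
            (Valued.integer (w.1.adicCompletion L))) ≤ scaleLattice (ϖ ^ b) M} := by
  rw [placeForm_antidiagOne, ← antidiagonal_three_over_eq_block_antidiagonal_two]
  rfl

/-- **(L0-P) THE DEPTH PIECE `levels_{a,·}`** (one level token only = ★ p858894's family at `c := ϖ^a`, `(H₂, hW) := (placeForm Φ₂ w, 1)`).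
[cite: Kottwitz1986BaseChangeUnits, §1 pp. 240–241] [cite: Rogawski1990, §4.9 Prop. 4.9.1 (b) p. 55] -/
theorem setOf_typeZero_fixed_level_eq_block (L : Type) [Field L] [NumberField L] [IsCMField L]
    {v : HeightOneSpectrum (𝓞 ↥(maximalRealSubfield L))} (w : UnitaryGroup.PlacesOver L v)
    (hw : IsCMField.complexConj L • w.1 = w.1) (ϖ : w.1.adicCompletion L) (Γ : GL (Fin 3) (w.1.adicCompletion L)) (a : ℕ) :
    {M : Submodule (Valued.integer (w.1.adicCompletion L)) (Fin 3 → (w.1.adicCompletion L)) |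
        IsVertexLattice (galAdicCompletionMap (L := L) (IsCMField.complexConj L) hw) ϖ ((StdForm.antidiagonal 3).over (w.1.adicCompletion L)) 0 M ∧ mapGL Γ M = M ∧
          LatticeInLevel ϖ a ((Γ : Matrix (Fin 3) (Fin 3) (w.1.adicCompletion L)) - 1) M} =
      {M : Submodule (Valued.integer (w.1.adicCompletion L)) (Fin 3 → (w.1.adicCompletion L)) |
        IsSelfDualLattice (galAdicCompletionMap (L := L) (IsCMField.complexConj L) hw) ϖ
          (!![(placeForm (Matrix.of fun i j : Fin 2 => if i.val + j.val + 1 = 2 then (1 : L) else 0) w.1) 0 0, 0,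
              (placeForm (Matrix.of fun i j : Fin 2 => if i.val + j.val + 1 = 2 then (1 : L) else 0) w.1) 0 1;
             0, (1 : w.1.adicCompletion L), 0;
             (placeForm (Matrix.of fun i j : Fin 2 => if i.val + j.val + 1 = 2 then (1 : L) else 0) w.1) 1 0, 0,
              (placeForm (Matrix.of fun i j : Fin 2 => if i.val + j.val + 1 = 2 then (1 : L) else 0) w.1) 1 1] : Matrix (Fin 3) (Fin 3) (w.1.adicCompletion L)) M ∧
        mapGL Γ M = M ∧
          M.map ((Matrix.toLin' ((Γ : Matrix (Fin 3) (Fin 3) (w.1.adicCompletion L)) - 1)).restrictScalars (Valued.integer (w.1.adicCompletion L))) ≤ scaleLattice (ϖ ^ a) M} := by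
  rw [placeForm_antidiagOne, ← antidiagonal_three_over_eq_block_antidiagonal_two]
  rfl

/-! ## §2 The counted forms -/

/-- **(L0-P) counted**: the levels piece's lattice count IS the block-form two-token census count (`congrArg Set.ncard` of §1). [cite: Kottwitz1986BaseChangeUnits, §1 pp. 240–241] -/
theorem ncard_typeZero_fixed_levels_eq_block (L : Type) [Field L] [NumberField L] [IsCMField L]
    {v : HeightOneSpectrum (𝓞 ↥(maximalRealSubfield L))} (w : UnitaryGroup.PlacesOver L v)
    (hw : IsCMField.complexConj L • w.1 = w.1) (ϖ : w.1.adicCompletion L) (Γ : GL (Fin 3) (w.1.adicCompletion L)) (a b : ℕ) :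
    {M : Submodule (Valued.integer (w.1.adicCompletion L)) (Fin 3 → (w.1.adicCompletion L)) |
        IsVertexLattice (galAdicCompletionMap (L := L) (IsCMField.complexConj L) hw) ϖ ((StdForm.antidiagonal 3).over (w.1.adicCompletion L)) 0 M ∧ mapGL Γ M = M ∧
          (LatticeInLevel ϖ a ((Γ : Matrix (Fin 3) (Fin 3) (w.1.adicCompletion L)) - 1) M ∧
            LatticeInLevel ϖ b (((Γ : Matrix (Fin 3) (Fin 3) (w.1.adicCompletion L)) - 1) * ((Γ : Matrix (Fin 3) (Fin 3) (w.1.adicCompletion L)) - 1)) M)}.ncard =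
      {M : Submodule (Valued.integer (w.1.adicCompletion L)) (Fin 3 → (w.1.adicCompletion L)) |
        IsSelfDualLattice (galAdicCompletionMap (L := L) (IsCMField.complexConj L) hw) ϖ
          (!![(placeForm (Matrix.of fun i j : Fin 2 => if i.val + j.val + 1 = 2 then (1 : L) else 0) w.1) 0 0, 0,
              (placeForm (Matrix.of fun i j : Fin 2 => if i.val + j.val + 1 = 2 then (1 : L) else 0) w.1) 0 1;
             0, (1 : w.1.adicCompletion L), 0;
             (placeForm (Matrix.of fun i j : Fin 2 => if i.val + j.val + 1 = 2 then (1 : L) else 0) w.1) 1 0, 0,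
              (placeForm (Matrix.of fun i j : Fin 2 => if i.val + j.val + 1 = 2 then (1 : L) else 0) w.1) 1 1] : Matrix (Fin 3) (Fin 3) (w.1.adicCompletion L)) M ∧
        mapGL Γ M = M ∧
          M.map ((Matrix.toLin' ((Γ : Matrix (Fin 3) (Fin 3) (w.1.adicCompletion L)) - 1)).restrictScalars (Valued.integer (w.1.adicCompletion L))) ≤ scaleLattice (ϖ ^ a) M ∧
          M.map ((Matrix.toLin' (((Γ : Matrix (Fin 3) (Fin 3) (w.1.adicCompletion L)) - 1) * ((Γ : Matrix (Fin 3) (Fin 3) (w.1.adicCompletion L)) - 1))).restrictScalars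
            (Valued.integer (w.1.adicCompletion L))) ≤ scaleLattice (ϖ ^ b) M}.ncard := by
  rw [setOf_typeZero_fixed_levels_eq_block]

/-- **(L0-P) counted**: the square piece's lattice count IS the block-form square-token census count. [cite: Kottwitz1986BaseChangeUnits, §1 pp. 240–241] -/
theorem ncard_typeZero_fixed_sqLevel_eq_block (L : Type) [Field L] [NumberField L] [IsCMField L]
    {v : HeightOneSpectrum (𝓞 ↥(maximalRealSubfield L))} (w : UnitaryGroup.PlacesOver L v)
    (hw : IsCMField.complexConj L • w.1 = w.1) (ϖ : w.1.adicCompletion L) (Γ : GL (Fin 3) (w.1.adicCompletion L)) (b : ℕ) :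
    {M : Submodule (Valued.integer (w.1.adicCompletion L)) (Fin 3 → (w.1.adicCompletion L)) |
        IsVertexLattice (galAdicCompletionMap (L := L) (IsCMField.complexConj L) hw) ϖ ((StdForm.antidiagonal 3).over (w.1.adicCompletion L)) 0 M ∧ mapGL Γ M = M ∧
          LatticeInLevel ϖ b (((Γ : Matrix (Fin 3) (Fin 3) (w.1.adicCompletion L)) - 1) * ((Γ : Matrix (Fin 3) (Fin 3) (w.1.adicCompletion L)) - 1)) M}.ncard =
      {M : Submodule (Valued.integer (w.1.adicCompletion L)) (Fin 3 → (w.1.adicCompletion L)) |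
        IsSelfDualLattice (galAdicCompletionMap (L := L) (IsCMField.complexConj L) hw) ϖ
          (!![(placeForm (Matrix.of fun i j : Fin 2 => if i.val + j.val + 1 = 2 then (1 : L) else 0) w.1) 0 0, 0,
              (placeForm (Matrix.of fun i j : Fin 2 => if i.val + j.val + 1 = 2 then (1 : L) else 0) w.1) 0 1;
             0, (1 : w.1.adicCompletion L), 0;
             (placeForm (Matrix.of fun i j : Fin 2 => if i.val + j.val + 1 = 2 then (1 : L) else 0) w.1) 1 0, 0,
              (placeForm (Matrix.of fun i j : Fin 2 => if i.val + j.val + 1 = 2 then (1 : L) else 0) w.1) 1 1] : Matrix (Fin 3) (Fin 3) (w.1.adicCompletion L)) M ∧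
        mapGL Γ M = M ∧
          M.map ((Matrix.toLin' (((Γ : Matrix (Fin 3) (Fin 3) (w.1.adicCompletion L)) - 1) * ((Γ : Matrix (Fin 3) (Fin 3) (w.1.adicCompletion L)) - 1))).restrictScalars
            (Valued.integer (w.1.adicCompletion L))) ≤ scaleLattice (ϖ ^ b) M}.ncard := by
  rw [setOf_typeZero_fixed_sqLevel_eq_block]

/-- **(L0-P) counted**: the depth piece's lattice count IS the block-form depth-token census count. [cite: Kottwitz1986BaseChangeUnits, §1 pp. 240–241] -/
theorem ncard_typeZero_fixed_level_eq_block (L : Type) [Field L] [NumberField L] [IsCMField L]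
    {v : HeightOneSpectrum (𝓞 ↥(maximalRealSubfield L))} (w : UnitaryGroup.PlacesOver L v)
    (hw : IsCMField.complexConj L • w.1 = w.1) (ϖ : w.1.adicCompletion L) (Γ : GL (Fin 3) (w.1.adicCompletion L)) (a : ℕ) :
    {M : Submodule (Valued.integer (w.1.adicCompletion L)) (Fin 3 → (w.1.adicCompletion L)) |
        IsVertexLattice (galAdicCompletionMap (L := L) (IsCMField.complexConj L) hw) ϖ ((StdForm.antidiagonal 3).over (w.1.adicCompletion L)) 0 M ∧ mapGL Γ M = M ∧
          LatticeInLevel ϖ a ((Γ : Matrix (Fin 3) (Fin 3) (w.1.adicCompletion L)) - 1) M}.ncard =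
      {M : Submodule (Valued.integer (w.1.adicCompletion L)) (Fin 3 → (w.1.adicCompletion L)) |
        IsSelfDualLattice (galAdicCompletionMap (L := L) (IsCMField.complexConj L) hw) ϖ
          (!![(placeForm (Matrix.of fun i j : Fin 2 => if i.val + j.val + 1 = 2 then (1 : L) else 0) w.1) 0 0, 0,
              (placeForm (Matrix.of fun i j : Fin 2 => if i.val + j.val + 1 = 2 then (1 : L) else 0) w.1) 0 1;
             0, (1 : w.1.adicCompletion L), 0;
             (placeForm (Matrix.of fun i j : Fin 2 => if i.val + j.val + 1 = 2 then (1 : L) else 0) w.1) 1 0, 0,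
              (placeForm (Matrix.of fun i j : Fin 2 => if i.val + j.val + 1 = 2 then (1 : L) else 0) w.1) 1 1] : Matrix (Fin 3) (Fin 3) (w.1.adicCompletion L)) M ∧
        mapGL Γ M = M ∧
          M.map ((Matrix.toLin' ((Γ : Matrix (Fin 3) (Fin 3) (w.1.adicCompletion L)) - 1)).restrictScalars (Valued.integer (w.1.adicCompletion L))) ≤ scaleLattice (ϖ ^ a) M}.ncard := by
  rw [setOf_typeZero_fixed_level_eq_block]

end Summit.HodgeConjecture.HodgeConjecture.Cruxes.H413.F0P3cDyRamProfilePiecesTypeTwoLatticeBridge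

end
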